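import Summits.CriticalPhenomena.PercolationContinuityZ3.Theorems.PercNearOneGluingNoHeavyLowerTailSahiThreeCopyNested

/-!
# `NoHeavyLowerTail` (crux stmt-CriticalPhenomena-4575), Sahi programme: **3C-SAHI WITH ONE CUMULATION SLOT, coefficientwise** —
# `c_b(a, g, h) ≥ 0` at EVERY profile when `a` is a product of one-coordinate factors (e.g. the indicator of a principal up-set
# / cylinder event `[x_i = 1 ∀ i ∈ S]`) and `g, h` are ARBITRARY nonnegative monotone functions

Support file (Sahi cell, seat `prim-sahi-p1`, generation 53; `--supports stmt-CriticalPhenomena-4575`); companion of `…SahiThreeCopy`,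
`…SahiThreeCopyBernstein`, `…SahiThreeCopyNested`.  Pure proofs plus two definitions (`R3`, `cprod`); no `sorry`, standard axioms.

THE DECOMPOSITION.  `c_b(a,g,h) = [N_b(agh;1;1) − N_b(a;gh;1)] + R_b(a;g,h)` (`tc_eq_harris_add_R3`) with the THREE-COPY CONDITIONAL
COVARIANCE `R_b(a;g,h) := N_b(agh;1;1) − N_b(ag;h;1) − N_b(ah;g;1) + N_b(a;g;h)` (`R3`; at law level `E[a·(g − Eg)(h − Eh)]`, so that
`E₃ = Cov(a,gh) + E[a ĝ ĥ]`).  The first bracket is a three-copy Harris gap, nonnegative by `N3_le_N3_mul`.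

THE THEOREM (`R3_cprod_nonneg`, `tc_cprod_nonneg`): if `a = cprod α β : x ↦ Π_i (α_i + β_i x_i)` with `α, β ≥ 0` (a nonnegative
combination of such is Sahi's cumulation cone; `α = 0, β = 1_S` gives the cylinder `1_{↑S}`), then for EVERY profile `b` and all
nonnegative monotone `g, h`: `0 ≤ R_b(a;g,h)` and hence `0 ≤ c_b(a,g,h)`.  So the census's conjecture 3C-SAHI (CENSUS §175 / W197)
HOLDS ON THE CLASS "one cumulation slot, two arbitrary slots" — the coefficientwise (minimal tensor-Bernstein multidegree) form of the
tree's law-level `sahiE3_cylinder_nonneg` / `latticeE3_nonneg_of_principal` for product measures.  PROOF: induction on `d` through the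
slice recursion `N3_cons`; along coordinate `0` the sections of `a` are `α₀·a'` and `(α₀+β₀)·a'`; the type-1 slice is
`(α₀+β₀)·X + α₀·Y` with `X ≥ R(a';g¹,h¹) ≥ 0` (two three-copy Harris gaps with the spectators `h¹−h⁰`, `g¹−g⁰`) and
`X + Y = R(a';g⁰,h⁰) + R(a';g¹,h⁰) + R(a';g⁰,h¹) + N(a'(g¹−g⁰)(h¹−h⁰);1;1) ≥ 0`; the type-2 slice is `α₀·X₂ + (α₀+β₀)·Y₂` with
`Y₂ ≥ 2R(a';g¹,h¹)` and the same sum.  Events form: `tc_setInd_principal_nonneg` (`A = ↑m` principal, `B, C` any up-sets).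
[this work; conjecture: CENSUS §175 W197 (prim-sahi-census gen 54); law-level cumulation results: Sahi2008 Thm. 2]
-/

namespace Summit.CriticalPhenomena.PercolationContinuityZ3.Theorems.SahiThreeCopy

open Finset Function Literature.Combinatorics.Sahi2008
open scoped BigOperators

noncomputable section

variable {d : ℕ}

/-! ### §1 The three-copy conditional covariance `R_b` -/

/-- `R_b(a;g,h) := N_b(agh;1;1) − N_b(ag;h;1) − N_b(ah;g;1) + N_b(a;g;h)` — three-copy form of `E[a·(g − Eg)·(h − Eh)]`. [this work] -/
def R3 (b : Fin d → ℕ) (a g h : Pt d → ℝ) : ℝ :=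
  N3 b (a * g * h) 1 1 - N3 b (a * g) h 1 - N3 b (a * h) g 1 + N3 b a g h

/-- **`c_b = Harris gap + R_b`**: `c_b(a,g,h) = [N_b(agh;1;1) − N_b(a;gh;1)] + R_b(a;g,h)`. [this work] -/
theorem tc_eq_harris_add_R3 (b : Fin d → ℕ) (a g h : Pt d → ℝ) :
    tc b a g h = (N3 b (a * g * h) 1 1 - N3 b a (g * h) 1) + R3 b a g h := by
  unfold tc R3
  rw [N3_comm12 b g (a * h) 1, N3_comm12 b h (a * g) 1]
  ring

/-- The mixed expansion `N_b(a(g₁−g₀)(h₁−h₀);1;1) = N(ag₁h₁) − N(ag₁h₀) − N(ag₀h₁) + N(ag₀h₀)`. [this work] -/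
theorem N3_mul_sub_mul_sub (b : Fin d → ℕ) (a g₁ g₀ h₁ h₀ : Pt d → ℝ) :
    N3 b (a * (g₁ - g₀) * (h₁ - h₀)) 1 1 =
      N3 b (a * g₁ * h₁) 1 1 - N3 b (a * g₁ * h₀) 1 1 - N3 b (a * g₀ * h₁) 1 1 + N3 b (a * g₀ * h₀) 1 1 := by
  have : a * (g₁ - g₀) * (h₁ - h₀) = a * g₁ * h₁ - a * g₁ * h₀ - (a * g₀ * h₁ - a * g₀ * h₀) := by ring
  rw [this, N3_sub_left, N3_sub_left, N3_sub_left]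
  ring

/-! ### §2 The slice inequalities for `R_b` (sections `g⁰ ≤ g¹`, `h⁰ ≤ h¹`) -/

section Slices

variable (b : Fin d → ℕ) {a g₀ g₁ h₀ h₁ : Pt d → ℝ}

/-- Type-1 piece: `X := N(ag₁h₁) − N(ag₁;h₀) − N(ah₁;g₀) + N(a;g₀;h₀) ≥ R_b(a;g₁,h₁)`. [this work] -/
theorem R3_le_sliceX (ha : ∀ x, 0 ≤ a x) (ham : Monotone a) (hg₁ : ∀ x, 0 ≤ g₁ x)
    (hg₁m : Monotone g₁) (hh₀ : ∀ x, 0 ≤ h₀ x) (hh₀m : Monotone h₀)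
    (hg : ∀ x, g₀ x ≤ g₁ x) (hh : ∀ x, h₀ x ≤ h₁ x) :
    R3 b a g₁ h₁ ≤ N3 b (a * g₁ * h₁) 1 1 - N3 b (a * g₁) h₀ 1 - N3 b (a * h₁) g₀ 1 + N3 b a g₀ h₀ := by
  have hδh : ∀ x, 0 ≤ (h₁ - h₀) x := fun x => sub_nonneg.2 (hh x)
  have hδg : ∀ x, 0 ≤ (g₁ - g₀) x := fun x => sub_nonneg.2 (hg x)
  -- Harris with spectator h₁ − h₀
  have H1 := N3_le_N3_mul d b a g₁ (h₁ - h₀) ha ham hg₁ hg₁m hδh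
  -- Harris with spectator g₁ − g₀, then monotonicity a h₀ ≤ a h₁ in the first slot
  have H2 := N3_le_N3_mul d b a h₀ (g₁ - g₀) ha ham hh₀ hh₀m hδg
  have M2 : N3 b (a * h₀) 1 (g₁ - g₀) ≤ N3 b (a * h₁) 1 (g₁ - g₀) :=
    N3_mono_left b (fun x => mul_le_mul_of_nonneg_left (hh x) (ha x)) (fun _ => zero_le_one) hδg
  have e1 : N3 b (a * g₁) 1 (h₁ - h₀) = N3 b (a * g₁) h₁ 1 - N3 b (a * g₁) h₀ 1 := by
    rw [N3_comm23, N3_sub_mid]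
  have e2 : N3 b a g₁ (h₁ - h₀) = N3 b a g₁ h₁ - N3 b a g₁ h₀ := N3_sub_right b a g₁ h₁ h₀
  have e3 : N3 b a h₀ (g₁ - g₀) = N3 b a g₁ h₀ - N3 b a g₀ h₀ := by
    rw [N3_sub_right, N3_comm23 b a h₀ g₁, N3_comm23 b a h₀ g₀]
  have e4 : N3 b (a * h₁) 1 (g₁ - g₀) = N3 b (a * h₁) g₁ 1 - N3 b (a * h₁) g₀ 1 := by
    rw [N3_comm23, N3_sub_mid]
  unfold R3
  linarith

/-- Type-2 piece: `Y₂ := 2N(ag₁h₁) − N(ag₁;h₀) − N(ag₁;h₁) − N(ah₁;g₀) − N(ah₁;g₁) + N(a;g₀;h₁) + N(a;g₁;h₀) ≥ 2R_b(a;g₁,h₁)`. [this work] -/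
theorem two_R3_le_sliceY (ha : ∀ x, 0 ≤ a x) (ham : Monotone a) (hg₁ : ∀ x, 0 ≤ g₁ x) (hg₁m : Monotone g₁)
    (hh₁ : ∀ x, 0 ≤ h₁ x) (hh₁m : Monotone h₁) (hg : ∀ x, g₀ x ≤ g₁ x) (hh : ∀ x, h₀ x ≤ h₁ x) :
    2 * R3 b a g₁ h₁ ≤ 2 * N3 b (a * g₁ * h₁) 1 1 - N3 b (a * g₁) h₀ 1 - N3 b (a * g₁) h₁ 1 - N3 b (a * h₁) g₀ 1 -
      N3 b (a * h₁) g₁ 1 + N3 b a g₀ h₁ + N3 b a g₁ h₀ := by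
  have hδh : ∀ x, 0 ≤ (h₁ - h₀) x := fun x => sub_nonneg.2 (hh x)
  have hδg : ∀ x, 0 ≤ (g₁ - g₀) x := fun x => sub_nonneg.2 (hg x)
  have H1 := N3_le_N3_mul d b a g₁ (h₁ - h₀) ha ham hg₁ hg₁m hδh
  have H2 := N3_le_N3_mul d b a h₁ (g₁ - g₀) ha ham hh₁ hh₁m hδg
  have e1 : N3 b (a * g₁) 1 (h₁ - h₀) = N3 b (a * g₁) h₁ 1 - N3 b (a * g₁) h₀ 1 := by
    rw [N3_comm23, N3_sub_mid]
  have e2 : N3 b a g₁ (h₁ - h₀) = N3 b a g₁ h₁ - N3 b a g₁ h₀ := N3_sub_right b a g₁ h₁ h₀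
  have e3 : N3 b a h₁ (g₁ - g₀) = N3 b a g₁ h₁ - N3 b a g₀ h₁ := by
    rw [N3_sub_right, N3_comm23 b a h₁ g₁, N3_comm23 b a h₁ g₀]
  have e4 : N3 b (a * h₁) 1 (g₁ - g₀) = N3 b (a * h₁) g₁ 1 - N3 b (a * h₁) g₀ 1 := by
    rw [N3_comm23, N3_sub_mid]
  unfold R3
  linarith

/-- The common sum: `X + Y = R(a;g₀,h₀) + R(a;g₁,h₀) + R(a;g₀,h₁) + N(a(g₁−g₀)(h₁−h₀);1;1)` (type 1) — as an inequality
`X + Y ≥ 0` given the three `R ≥ 0` and `a, g₁−g₀, h₁−h₀ ≥ 0`. [this work] -/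
theorem sliceXY_nonneg (ha : ∀ x, 0 ≤ a x) (hg : ∀ x, g₀ x ≤ g₁ x) (hh : ∀ x, h₀ x ≤ h₁ x)
    (R00 : 0 ≤ R3 b a g₀ h₀) (R10 : 0 ≤ R3 b a g₁ h₀) (R01 : 0 ≤ R3 b a g₀ h₁) :
    0 ≤ (N3 b (a * g₁ * h₁) 1 1 - N3 b (a * g₁) h₀ 1 - N3 b (a * h₁) g₀ 1 + N3 b a g₀ h₀) +
      (2 * N3 b (a * g₀ * h₀) 1 1 - N3 b (a * g₀) h₁ 1 - N3 b (a * g₀) h₀ 1 - N3 b (a * h₀) g₁ 1 - N3 b (a * h₀) g₀ 1 +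
        N3 b a g₁ h₀ + N3 b a g₀ h₁) := by
  have hmix := N3_nonneg b (f := a * (g₁ - g₀) * (h₁ - h₀)) (g := 1) (h := 1)
    (fun x => mul_nonneg (mul_nonneg (ha x) (sub_nonneg.2 (hg x))) (sub_nonneg.2 (hh x)))
    (fun _ => zero_le_one) (fun _ => zero_le_one)
  rw [N3_mul_sub_mul_sub] at hmix
  unfold R3 at R00 R10 R01
  linarith

/-- The same sum organised for type 2: `X₂ + Y₂ = R(a;g₁,h₁) + R(a;g₀,h₁) + R(a;g₁,h₀) + N(a(g₁−g₀)(h₁−h₀);1;1) ≥ 0`. [this work] -/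
theorem sliceXY_nonneg₂ (ha : ∀ x, 0 ≤ a x) (hg : ∀ x, g₀ x ≤ g₁ x) (hh : ∀ x, h₀ x ≤ h₁ x)
    (R11 : 0 ≤ R3 b a g₁ h₁) (R10 : 0 ≤ R3 b a g₁ h₀) (R01 : 0 ≤ R3 b a g₀ h₁) :
    0 ≤ (N3 b (a * g₀ * h₀) 1 1 - N3 b (a * g₀) h₁ 1 - N3 b (a * h₀) g₁ 1 + N3 b a g₁ h₁) +
      (2 * N3 b (a * g₁ * h₁) 1 1 - N3 b (a * g₁) h₀ 1 - N3 b (a * g₁) h₁ 1 - N3 b (a * h₁) g₀ 1 - N3 b (a * h₁) g₁ 1 +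
        N3 b a g₀ h₁ + N3 b a g₁ h₀) := by
  have hmix := N3_nonneg b (f := a * (g₁ - g₀) * (h₁ - h₀)) (g := 1) (h := 1)
    (fun x => mul_nonneg (mul_nonneg (ha x) (sub_nonneg.2 (hg x))) (sub_nonneg.2 (hh x)))
    (fun _ => zero_le_one) (fun _ => zero_le_one)
  rw [N3_mul_sub_mul_sub] at hmix
  unfold R3 at R11 R10 R01
  linarith

end Slices

/-! ### §3 Slices of `R_b` when the first slot has scalar sections `a⁰ = c₀·a'`, `a¹ = c₁·a'` -/

/-- Type-1 slice of `R_b`. [this work] -/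
theorem R3_cons_one (b : Fin d → ℕ) (a g h : Pt (d + 1) → ℝ) {a' : Pt d → ℝ} {c₀ c₁ : ℝ}
    (h0 : sec a false = c₀ • a') (h1 : sec a true = c₁ • a') :
    R3 (Fin.cons 1 b : Fin (d + 1) → ℕ) a g h =
      c₁ * (N3 b (a' * sec g true * sec h true) 1 1 - N3 b (a' * sec g true) (sec h false) 1 -
          N3 b (a' * sec h true) (sec g false) 1 + N3 b a' (sec g false) (sec h false)) +
      c₀ * (2 * N3 b (a' * sec g false * sec h false) 1 1 - N3 b (a' * sec g false) (sec h true) 1 -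
          N3 b (a' * sec g false) (sec h false) 1 - N3 b (a' * sec h false) (sec g true) 1 -
          N3 b (a' * sec h false) (sec g false) 1 + N3 b a' (sec g true) (sec h false) + N3 b a' (sec g false) (sec h true)) := by
  unfold R3
  rw [N3_cons_one, N3_cons_one, N3_cons_one, N3_cons_one]
  simp only [sec_mul, sec_one, h0, h1, smul_mul_assoc, N3_smul_left]
  ring

/-- Type-2 slice of `R_b`. [this work] -/
theorem R3_cons_two (b : Fin d → ℕ) (a g h : Pt (d + 1) → ℝ) {a' : Pt d → ℝ} {c₀ c₁ : ℝ}
    (h0 : sec a false = c₀ • a') (h1 : sec a true = c₁ • a') :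
    R3 (Fin.cons 2 b : Fin (d + 1) → ℕ) a g h =
      c₀ * (N3 b (a' * sec g false * sec h false) 1 1 - N3 b (a' * sec g false) (sec h true) 1 -
          N3 b (a' * sec h false) (sec g true) 1 + N3 b a' (sec g true) (sec h true)) +
      c₁ * (2 * N3 b (a' * sec g true * sec h true) 1 1 - N3 b (a' * sec g true) (sec h false) 1 -
          N3 b (a' * sec g true) (sec h true) 1 - N3 b (a' * sec h true) (sec g false) 1 -
          N3 b (a' * sec h true) (sec g true) 1 + N3 b a' (sec g false) (sec h true) + N3 b a' (sec g true) (sec h false)) := by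
  unfold R3
  rw [N3_cons_two, N3_cons_two, N3_cons_two, N3_cons_two]
  simp only [sec_mul, sec_one, h0, h1, smul_mul_assoc, N3_smul_left]
  ring

/-- Type-0 slice of `R_b`. [this work] -/
theorem R3_cons_zero (b : Fin d → ℕ) (a g h : Pt (d + 1) → ℝ) {a' : Pt d → ℝ} {c₀ : ℝ} (h0 : sec a false = c₀ • a') :
    R3 (Fin.cons 0 b : Fin (d + 1) → ℕ) a g h = c₀ * R3 b a' (sec g false) (sec h false) := by
  unfold R3
  rw [N3_cons_zero, N3_cons_zero, N3_cons_zero, N3_cons_zero]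
  simp only [sec_mul, sec_one, h0, smul_mul_assoc, N3_smul_left]
  ring

/-- Type-3 slice of `R_b`. [this work] -/
theorem R3_cons_three (b : Fin d → ℕ) (a g h : Pt (d + 1) → ℝ) {a' : Pt d → ℝ} {c₁ : ℝ} (h1 : sec a true = c₁ • a') :
    R3 (Fin.cons 3 b : Fin (d + 1) → ℕ) a g h = c₁ * R3 b a' (sec g true) (sec h true) := by
  unfold R3
  rw [N3_cons_three, N3_cons_three, N3_cons_three, N3_cons_three]
  simp only [sec_mul, sec_one, h1, smul_mul_assoc, N3_smul_left]
  ring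

/-- Empty slices. [this work] -/
theorem R3_cons_add_four (k : ℕ) (b : Fin d → ℕ) (a g h : Pt (d + 1) → ℝ) :
    R3 (Fin.cons (k + 4) b : Fin (d + 1) → ℕ) a g h = 0 := by
  unfold R3
  rw [N3_cons_add_four, N3_cons_add_four, N3_cons_add_four, N3_cons_add_four]
  ring

/-! ### §4 Coordinate products (one cumulation slot) -/

/-- The COORDINATE PRODUCT `x ↦ Π_i (α_i + β_i·x_i)` (`α = 0, β = 1_S·1`: the cylinder / principal up-set indicator `1_{↑S}`).
[this work; cf. Sahi2008, Thm. 2 (cumulations)] -/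
def cprod (α β : Fin d → ℝ) : Pt d → ℝ := fun x => ∏ i, (α i + if x i then β i else 0)

/-- Coordinate products with `α, β ≥ 0` are nonnegative. [this work] -/
theorem cprod_nonneg {α β : Fin d → ℝ} (hα : ∀ i, 0 ≤ α i) (hβ : ∀ i, 0 ≤ β i) (x : Pt d) : 0 ≤ cprod α β x :=
  prod_nonneg fun i _ => add_nonneg (hα i) (by split_ifs; exacts [hβ i, le_rfl])

/-- Coordinate products with `α, β ≥ 0` are monotone. [this work] -/
theorem cprod_monotone {α β : Fin d → ℝ} (hα : ∀ i, 0 ≤ α i) (hβ : ∀ i, 0 ≤ β i) : Monotone (cprod α β) := by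
  intro x y hxy
  unfold cprod
  refine prod_le_prod (fun i _ => add_nonneg (hα i) (by split_ifs; exacts [hβ i, le_rfl])) fun i _ => ?_
  have hi : x i = true → y i = true := Bool.le_iff_imp.1 (hxy i)
  refine add_le_add le_rfl ?_
  by_cases hx : x i = true
  · rw [if_pos hx, if_pos (hi hx)]
  · rw [if_neg hx]
    split_ifs
    · exact hβ i
    · exact le_rfl

/-- Sections of a coordinate product along coordinate `0` are scalar multiples of the tail product. [this work] -/
theorem sec_cprod (α β : Fin (d + 1) → ℝ) (ε : Bool) :
    sec (cprod α β) ε = (α 0 + if ε then β 0 else 0) • cprod (Fin.tail α) (Fin.tail β) := by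
  funext x
  simp only [sec, cprod, Pi.smul_apply, smul_eq_mul]
  rw [Fin.prod_univ_succ]
  simp only [Fin.cons_zero, Fin.cons_succ, Fin.tail]

/-- **`R_b(a;g,h) ≥ 0` for a coordinate product `a` and arbitrary nonnegative monotone `g, h`**, every profile `b`
(induction on the dimension through the slice recursion). [this work] -/
theorem R3_cprod_nonneg : ∀ (d : ℕ) (b : Fin d → ℕ) (α β : Fin d → ℝ) (g h : Pt d → ℝ), (∀ i, 0 ≤ α i) → (∀ i, 0 ≤ β i) →
    (∀ x, 0 ≤ g x) → Monotone g → (∀ x, 0 ≤ h x) → Monotone h → 0 ≤ R3 b (cprod α β) g h := by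
  intro d
  induction d with
  | zero =>
    intro b α β g h _ _ _ _ _ _
    have : R3 b (cprod α β) g h = 0 := by
      unfold R3
      rw [N3_dim_zero, N3_dim_zero, N3_dim_zero, N3_dim_zero]
      simp only [Pi.mul_apply, Pi.one_apply]
      ring
    rw [this]
  | succ d ih =>
    intro b α β g h hα hβ hg hgm hh hhm
    have hb : b = Fin.cons (b 0) (Fin.tail b) := (Fin.cons_self_tail b).symm
    set b' := Fin.tail b
    set a' := cprod (Fin.tail α) (Fin.tail β) with ha'
    have hα' : ∀ i, 0 ≤ Fin.tail α i := fun i => hα _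
    have hβ' : ∀ i, 0 ≤ Fin.tail β i := fun i => hβ _
    have ha0 : sec (cprod α β) false = (α 0) • a' := by rw [sec_cprod]; simp [ha']
    have ha1 : sec (cprod α β) true = (α 0 + β 0) • a' := by rw [sec_cprod]; simp [ha']
    have a'nn : ∀ x, 0 ≤ a' x := cprod_nonneg hα' hβ'
    have a'm : Monotone a' := cprod_monotone hα' hβ'
    -- sections of g, h
    have sg := sec_nonneg hg; have sh := sec_nonneg hh
    have mg := sec_monotone hgm; have mh := sec_monotone hhm
    have ng := sec_false_le_sec_true hgm; have nh := sec_false_le_sec_true hhm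
    have IH : ∀ ε₁ ε₂ : Bool, 0 ≤ R3 b' a' (sec g ε₁) (sec h ε₂) :=
      fun ε₁ ε₂ => ih b' _ _ _ _ hα' hβ' (sg ε₁) (mg ε₁) (sh ε₂) (mh ε₂)
    rw [hb]
    match hk : b 0 with
    | 0 =>
      rw [R3_cons_zero b' _ g h ha0]
      exact mul_nonneg (hα 0) (IH false false)
    | 1 =>
      rw [R3_cons_one b' _ g h ha0 ha1]
      have hX := R3_le_sliceX b' a'nn a'm (sg true) (mg true) (sh false) (mh false) ng nh
      have hXY := sliceXY_nonneg b' a'nn ng nh (IH false false) (IH true false) (IH false true)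
      have hX0 : 0 ≤ N3 b' (a' * sec g true * sec h true) 1 1 - N3 b' (a' * sec g true) (sec h false) 1 -
          N3 b' (a' * sec h true) (sec g false) 1 + N3 b' a' (sec g false) (sec h false) := le_trans (IH true true) hX
      nlinarith [mul_nonneg (hβ 0) hX0, mul_nonneg (hα 0) hXY]
    | 2 =>
      rw [R3_cons_two b' _ g h ha0 ha1]
      have hY := two_R3_le_sliceY b' a'nn a'm (sg true) (mg true) (sh true) (mh true) ng nh
      have hXY := sliceXY_nonneg₂ b' a'nn ng nh (IH true true) (IH true false) (IH false true)
      have hY0 : 0 ≤ 2 * N3 b' (a' * sec g true * sec h true) 1 1 - N3 b' (a' * sec g true) (sec h false) 1 -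
          N3 b' (a' * sec g true) (sec h true) 1 - N3 b' (a' * sec h true) (sec g false) 1 -
          N3 b' (a' * sec h true) (sec g true) 1 + N3 b' a' (sec g false) (sec h true) + N3 b' a' (sec g true) (sec h false) := by
        have := IH true true; linarith
      nlinarith [mul_nonneg (hβ 0) hY0, mul_nonneg (hα 0) hXY]
    | 3 =>
      rw [R3_cons_three b' _ g h ha1]
      exact mul_nonneg (add_nonneg (hα 0) (hβ 0)) (IH true true)
    | k + 4 =>
      rw [R3_cons_add_four]

/-- **3C-SAHI with one cumulation slot, coefficientwise**: for a coordinate product `a = Π_i(α_i + β_i x_i)`, `α, β ≥ 0`, and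
ARBITRARY nonnegative monotone `g, h` on `{0,1}^d`, the three-copy Sahi coefficient is nonnegative at every profile:
`0 ≤ c_b(a, g, h)`. [this work] -/
theorem tc_cprod_nonneg (b : Fin d → ℕ) {α β : Fin d → ℝ} (hα : ∀ i, 0 ≤ α i) (hβ : ∀ i, 0 ≤ β i) {g h : Pt d → ℝ}
    (hg : ∀ x, 0 ≤ g x) (hgm : Monotone g) (hh : ∀ x, 0 ≤ h x) (hhm : Monotone h) : 0 ≤ tc b (cprod α β) g h := by
  rw [tc_eq_harris_add_R3]
  refine add_nonneg ?_ (R3_cprod_nonneg d b α β g h hα hβ hg hgm hh hhm)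
  have H := N3_le_N3_mul d b (cprod α β) (g * h) 1 (cprod_nonneg hα hβ) (cprod_monotone hα hβ)
    (fun x => mul_nonneg (hg x) (hh x)) (hgm.mul hhm hg hh) fun _ => zero_le_one
  rw [← mul_assoc] at H
  exact sub_nonneg.2 H

/-- By symmetry the cumulation slot may be any of the three: `0 ≤ c_b(g, a, h)`. [this work] -/
theorem tc_cprod_nonneg_mid (b : Fin d → ℕ) {α β : Fin d → ℝ} (hα : ∀ i, 0 ≤ α i) (hβ : ∀ i, 0 ≤ β i) {g h : Pt d → ℝ}
    (hg : ∀ x, 0 ≤ g x) (hgm : Monotone g) (hh : ∀ x, 0 ≤ h x) (hhm : Monotone h) : 0 ≤ tc b g (cprod α β) h := by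
  rw [tc_comm12]; exact tc_cprod_nonneg b hα hβ hg hgm hh hhm

/-- The indicator of the principal up-set `↑m = {x : m ≤ x}` (the cylinder event `[x_i = 1 ∀ i ∈ m]`) is the coordinate product with
`α = 1 − 1_m`, `β = 1_m`. [this work] -/
theorem cprod_principal (m : Pt d) :
    cprod (fun i => if m i then 0 else 1) (fun i => if m i then 1 else 0) =
      setInd (univ.filter fun x : Pt d => ∀ i, m i = true → x i = true) := by
  funext x
  simp only [cprod, setInd, mem_filter, mem_univ, true_and]
  by_cases hmx : ∀ i, m i = true → x i = true
  · rw [if_pos hmx]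
    refine prod_eq_one fun i _ => ?_
    by_cases hm : m i = true
    · have hx := hmx i hm
      simp [hm, hx]
    · simp [hm]
  · rw [if_neg hmx]
    push Not at hmx
    obtain ⟨i, hmi, hxi⟩ := hmx
    refine prod_eq_zero (mem_univ i) ?_
    simp [hmi, hxi]

/-- **Events form**: for a PRINCIPAL up-set `A = ↑m = {x : x_i = 1 ∀ i ∈ m}` and ANY up-sets `B, C` of `{0,1}^d`, `c_b(1_A,1_B,1_C) ≥ 0` at
every profile — 3C-SAHI holds whenever one of the three events is a cylinder. [this work] -/
theorem tc_setInd_principal_nonneg (b : Fin d → ℕ) (m : Pt d) {B C : Finset (Pt d)} (hB : IsUpperSet (B : Set (Pt d)))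
    (hC : IsUpperSet (C : Set (Pt d))) :
    0 ≤ tc b (setInd (univ.filter fun x : Pt d => ∀ i, m i = true → x i = true)) (setInd B) (setInd C) := by
  rw [← cprod_principal]
  exact tc_cprod_nonneg b (fun i => by split_ifs <;> norm_num) (fun i => by split_ifs <;> norm_num)
    (setInd_nonneg B) (monotone_setInd hB) (setInd_nonneg C) (monotone_setInd hC)

end

end Summit.CriticalPhenomena.PercolationContinuityZ3.Theorems.SahiThreeCopy
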